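import Summits.KontsevichZagierPeriods.KontsevichZagierPeriods.Theorems.K2SymbolChainsJensenIsScissorsBaseLift
import Summits.KontsevichZagierPeriods.KontsevichZagierPeriods.Theorems.K2SymbolChainsJensenIsScissorsLastCoord

/-!
# `FigureEightIsTwoSmyth`: one-variable substitutions of the first base coordinate (helper)

Item stmt-KontsevichZagierPeriods-5203 of route K2SymbolChains. All post-Jensen representations
of the chain are open bands `{(t, s, u) | t ∈ I, s ∈ ℝ, 1 < u < q(t)}` in `ℝ³` over a base
`{b ∈ ℝ² | b 0 ∈ I}` whose second coordinate `s = b 1` is a spectator (weight `1/(1+s²)`). The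
substitutions of the chain (`t ↦ −t`, `t ↦ −1/t`, `t ↦ C(t) = cos 2θ`, `x ↦ Φ(x)`) act on the
first base coordinate only. This file packages, for a one-variable map `φ` with derivative `φ'`
on `I ⊆ ℝ`, injective on `I` and with `b ↦ φ (b 0)` `ℚ`-semialgebraic, the rule-2) data of the
base map `Ψ b = (φ (b 0), b 1)` (`baseMap_covData`: semialgebraic, derivative the continuous
linear map `v ↦ (φ'(b 0) v 0, v 1)` of determinant `φ'(b 0)`, injective; image
`{b | b 0 ∈ φ '' I}`), and the three consequences used downstream, through the lifting lemmas of
`…JensenIsScissorsBaseLift`: existence of the image representation, of the preimage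
representation, and `[r] − [r'] ∈ S` for matching representations, all for bands
`{1 < u < q}` with transported upper edge `q b = q' (Ψ b)` and Jacobian `|φ' (b 0)|`.
[Kontsevich–Zagier 2001, §1.2, rule 2)] [folklore]
-/

noncomputable section

open MeasureTheory Set
open Literature.NumberTheory.Transcendental Literature.ModelTheory.ExponentialFields
open Summit.KontsevichZagierPeriods.K2SymbolChains.JensenIsScissorsProof

-- single-conjunct summit: Sub = Summit, so the namespace segment repeats by design (CONVENTIONS §2)
set_option linter.dupNamespace false

namespace Summit.KontsevichZagierPeriods.KontsevichZagierPeriods.Theorems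

open Literature.NumberTheory.Transcendental.KZ

variable {S : AddSubgroup FormalRep}

/-! ### The derivative `v ↦ (a v 0, v 1)` and its determinant -/

/-- The continuous linear map `v ↦ (a · v 0, v 1)` of `ℝ²`, applied. [folklore] -/
theorem baseMapDeriv_apply (a : ℝ) (v : Fin 2 → ℝ) :
    (ContinuousLinearMap.pi ![a • ContinuousLinearMap.proj 0, ContinuousLinearMap.proj 1] :
      (Fin 2 → ℝ) →L[ℝ] (Fin 2 → ℝ)) v = ![a * v 0, v 1] := by
  funext i
  fin_cases i <;> simp

/-- **`det (v ↦ (a v 0, v 1)) = a`** (diagonal `2 × 2` matrix). [folklore] -/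
theorem det_baseMapDeriv (a : ℝ) :
    (ContinuousLinearMap.pi ![a • ContinuousLinearMap.proj 0, ContinuousLinearMap.proj 1] :
      (Fin 2 → ℝ) →L[ℝ] (Fin 2 → ℝ)).det = a := by
  rw [ContinuousLinearMap.det, ← LinearMap.det_toMatrix', Matrix.det_fin_two]
  simp [LinearMap.toMatrix'_apply]

/-! ### Rule-2) data of the base map `b ↦ (φ (b 0), b 1)` -/

/-- The base map applied to coordinates. [folklore] -/
theorem baseMap_apply_zero (φ : ℝ → ℝ) (b : Fin 2 → ℝ) : (![φ (b 0), b 1] : Fin 2 → ℝ) 0 = φ (b 0) := rfl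

/-- The base map applied to coordinates. [folklore] -/
theorem baseMap_apply_one (φ : ℝ → ℝ) (b : Fin 2 → ℝ) : (![φ (b 0), b 1] : Fin 2 → ℝ) 1 = b 1 := rfl

/-- **The base map has derivative `v ↦ (φ'(b 0) v 0, v 1)`.** [folklore] -/
theorem hasFDerivAt_baseMap {φ : ℝ → ℝ} {a : ℝ} {b : Fin 2 → ℝ} (hφ : HasDerivAt φ a (b 0)) :
    HasFDerivAt (fun b : Fin 2 → ℝ => (![φ (b 0), b 1] : Fin 2 → ℝ))
      (ContinuousLinearMap.pi ![a • ContinuousLinearMap.proj 0, ContinuousLinearMap.proj 1] :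
        (Fin 2 → ℝ) →L[ℝ] (Fin 2 → ℝ)) b := by
  rw [hasFDerivAt_pi']
  intro i
  fin_cases i
  · have h0 : HasFDerivAt (fun b : Fin 2 → ℝ => b 0) (ContinuousLinearMap.proj 0) b := hasFDerivAt_apply (𝕜 := ℝ) 0 b
    have h := hφ.comp_hasFDerivAt b h0
    refine (h.congr_fderiv ?_).congr_of_eventuallyEq (Filter.Eventually.of_forall fun v => rfl)
    ext v
    simp
  · have h1 : HasFDerivAt (fun b : Fin 2 → ℝ => b 1) (ContinuousLinearMap.proj 1) b := hasFDerivAt_apply (𝕜 := ℝ) 1 b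
    refine (h1.congr_fderiv ?_).congr_of_eventuallyEq (Filter.Eventually.of_forall fun v => rfl)
    ext v
    simp

/-- **The image of a first-coordinate cylinder under the base map**:
`Ψ '' {b | b 0 ∈ I} = {b | b 0 ∈ φ '' I}`. [folklore] -/
theorem image_baseMap (φ : ℝ → ℝ) (I : Set ℝ) :
    (fun b : Fin 2 → ℝ => (![φ (b 0), b 1] : Fin 2 → ℝ)) '' {b | b 0 ∈ I} = {b | b 0 ∈ φ '' I} := by
  ext b
  simp only [mem_image, mem_setOf_eq]
  constructor
  · rintro ⟨c, hc, rfl⟩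
    exact ⟨c 0, hc, rfl⟩
  · rintro ⟨t, ht, hb⟩
    refine ⟨![t, b 1], ht, ?_⟩
    funext i
    fin_cases i
    · simpa using hb
    · simp

/-- **The base map `b ↦ (φ (b 0), b 1)` is a rule-2) datum** on `σ = {b | b 0 ∈ I}`: a
`ℚ`-semialgebraic map (coordinatewise), with derivative `v ↦ (φ'(b 0) v 0, v 1)` within `σ`, and
injective on `σ` (as `φ` is on `I`). [Kontsevich–Zagier 2001, §1.2, rule 2)] [folklore] -/
theorem baseMap_covData {I : Set ℝ} {φ φ' : ℝ → ℝ} (hσ : IsSemialgebraic ℚ {b : Fin 2 → ℝ | b 0 ∈ I})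
    (hφs : IsSemialgebraicFunOn ℚ {b : Fin 2 → ℝ | b 0 ∈ I} (fun b => φ (b 0)))
    (hφ' : ∀ t ∈ I, HasDerivAt φ (φ' t) t) (hinj : InjOn φ I) :
    IsSemialgebraicMapOn ℚ {b : Fin 2 → ℝ | b 0 ∈ I} (fun b : Fin 2 → ℝ => (![φ (b 0), b 1] : Fin 2 → ℝ)) ∧
      (∀ b ∈ {b : Fin 2 → ℝ | b 0 ∈ I}, HasFDerivWithinAt (fun b : Fin 2 → ℝ => (![φ (b 0), b 1] : Fin 2 → ℝ))
        (ContinuousLinearMap.pi ![φ' (b 0) • ContinuousLinearMap.proj 0, ContinuousLinearMap.proj 1] :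
          (Fin 2 → ℝ) →L[ℝ] (Fin 2 → ℝ)) {b : Fin 2 → ℝ | b 0 ∈ I} b) ∧
      InjOn (fun b : Fin 2 → ℝ => (![φ (b 0), b 1] : Fin 2 → ℝ)) {b : Fin 2 → ℝ | b 0 ∈ I} := by
  refine ⟨?_, fun b hb => (hasFDerivAt_baseMap (hφ' _ hb)).hasFDerivWithinAt, ?_⟩
  · refine IsSemialgebraicMapOn.of_forall hσ fun j => ?_
    fin_cases j
    · exact hφs.congr fun b _ => rfl
    · exact (isSemialgebraicFunOn_apply hσ 1).congr fun b _ => rfl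
  · intro b hb b' hb' h
    have h0 : φ (b 0) = φ (b' 0) := by simpa using congrFun h 0
    have h1 : b 1 = b' 1 := by simpa using congrFun h 1
    funext i
    fin_cases i
    · exact hinj hb hb' h0
    · exact h1

/-! ### Image, preimage and matching of band representations under a base map -/

/-- **The image of a band representation under a base map exists.** Let `φ` be a rule-2) datum on
`I` as in `baseMap_covData` with `φ '' I = J`, and `r = [{(b,u) | b 0 ∈ I, 1 < u < q b}, f]` with
`f (b, u) = f' (Ψ b, u) · |φ' (b 0)|` on the domain, `q b = q' (Ψ b)` for `b 0 ∈ I`, and `f'`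
`ℚ`-semialgebraic on the image band `{b 0 ∈ J, 1 < u < q' b}`. Then the image representation
`r' = [{b 0 ∈ J, 1 < u < q' b}, f']` exists and `[r] − [r'] ∈ S`. [Kontsevich–Zagier 2001, §1.2,
rule 2)] [folklore] -/
theorem exists_image_baseMap (hS : domainAddRel ∪ integrandAddRel ∪ changeOfVariablesRel ⊆ S)
    {I J : Set ℝ} {φ φ' : ℝ → ℝ} (hσ : IsSemialgebraic ℚ {b : Fin 2 → ℝ | b 0 ∈ I})
    (hφs : IsSemialgebraicFunOn ℚ {b : Fin 2 → ℝ | b 0 ∈ I} (fun b => φ (b 0)))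
    (hφ' : ∀ t ∈ I, HasDerivAt φ (φ' t) t) (hinj : InjOn φ I) (hJ : φ '' I = J)
    {q q' : (Fin 2 → ℝ) → ℝ} (hqq' : ∀ b : Fin 2 → ℝ, b 0 ∈ I → q b = q' ![φ (b 0), b 1])
    (r : IntegralRep 3)
    (hr : r.domain = {z : Fin 3 → ℝ | Fin.init z ∈ {b : Fin 2 → ℝ | b 0 ∈ I} ∧ 1 < z (Fin.last 2) ∧
      z (Fin.last 2) < q (Fin.init z)})
    {f' : (Fin 3 → ℝ) → ℝ}
    (hf' : IsSemialgebraicFunOn ℚ {z : Fin 3 → ℝ | Fin.init z ∈ {b : Fin 2 → ℝ | b 0 ∈ J} ∧ 1 < z (Fin.last 2) ∧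
      z (Fin.last 2) < q' (Fin.init z)} f')
    (hint : ∀ z ∈ r.domain, r.integrand z =
      f' (Fin.snoc (![φ ((Fin.init z) 0), (Fin.init z) 1] : Fin 2 → ℝ) (z (Fin.last 2))) * |φ' ((Fin.init z) 0)|) :
    ∃ r' : IntegralRep 3, r'.domain = {z : Fin 3 → ℝ | Fin.init z ∈ {b : Fin 2 → ℝ | b 0 ∈ J} ∧ 1 < z (Fin.last 2) ∧
      z (Fin.last 2) < q' (Fin.init z)} ∧ r'.integrand = f' ∧ of r - of r' ∈ S := by
  obtain ⟨hΨ, hΨ', hinjΨ⟩ := baseMap_covData hσ hφs hφ' hinj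
  have himg := image_baseMap φ I
  refine exists_image_baseLift hS hΨ hΨ' hinjΨ r (fun z hz => by rw [hr] at hz; exact hz.1) ?_ ?_ hf' ?_
  · intro z hz
    rw [himg, hJ]
    exact hz.1
  · intro b hb u
    rw [hr]
    simp only [mem_setOf_eq, Fin.init_snoc, Fin.snoc_last, Matrix.cons_val_zero]
    rw [← hJ, hqq' b hb]
    exact ⟨fun h => ⟨mem_image_of_mem φ hb, h.2⟩, fun h => ⟨hb, h.2⟩⟩
  · intro z hz
    rw [hint z hz, det_baseMapDeriv]

/-- **The preimage of a band representation under a base map exists.** With `φ` as above,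
`φ '' I = J`, `q b = q' (Ψ b)` on `I`, a representation `r'` on the image band `{b 0 ∈ J, 1 < u < q' b}`,
and `f` `ℚ`-semialgebraic on `D = {b 0 ∈ I, 1 < u < q b}` with `f (b,u) = r'.integrand (Ψ b, u) · |φ'(b 0)|`
there: the representation `r = [D, f]` exists and `[r] − [r'] ∈ S`. [Kontsevich–Zagier 2001, §1.2,
rule 2)] [folklore] -/
theorem exists_preimage_baseMap (hS : domainAddRel ∪ integrandAddRel ∪ changeOfVariablesRel ⊆ S)
    {I J : Set ℝ} {φ φ' : ℝ → ℝ} (hσ : IsSemialgebraic ℚ {b : Fin 2 → ℝ | b 0 ∈ I})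
    (hφs : IsSemialgebraicFunOn ℚ {b : Fin 2 → ℝ | b 0 ∈ I} (fun b => φ (b 0)))
    (hφ' : ∀ t ∈ I, HasDerivAt φ (φ' t) t) (hinj : InjOn φ I) (hJ : φ '' I = J)
    {q q' : (Fin 2 → ℝ) → ℝ} (hq : IsSemialgebraicFunOn ℚ {b : Fin 2 → ℝ | b 0 ∈ I} q)
    (hqq' : ∀ b : Fin 2 → ℝ, b 0 ∈ I → q b = q' ![φ (b 0), b 1])
    (r' : IntegralRep 3)
    (hr' : r'.domain = {z : Fin 3 → ℝ | Fin.init z ∈ {b : Fin 2 → ℝ | b 0 ∈ J} ∧ 1 < z (Fin.last 2) ∧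
      z (Fin.last 2) < q' (Fin.init z)})
    {f : (Fin 3 → ℝ) → ℝ}
    (hf : IsSemialgebraicFunOn ℚ {z : Fin 3 → ℝ | Fin.init z ∈ {b : Fin 2 → ℝ | b 0 ∈ I} ∧ 1 < z (Fin.last 2) ∧
      z (Fin.last 2) < q (Fin.init z)} f)
    (hint : ∀ z ∈ {z : Fin 3 → ℝ | Fin.init z ∈ {b : Fin 2 → ℝ | b 0 ∈ I} ∧ 1 < z (Fin.last 2) ∧
      z (Fin.last 2) < q (Fin.init z)}, f z =
        r'.integrand (Fin.snoc (![φ ((Fin.init z) 0), (Fin.init z) 1] : Fin 2 → ℝ) (z (Fin.last 2))) *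
          |φ' ((Fin.init z) 0)|) :
    ∃ r : IntegralRep 3, r.domain = {z : Fin 3 → ℝ | Fin.init z ∈ {b : Fin 2 → ℝ | b 0 ∈ I} ∧ 1 < z (Fin.last 2) ∧
      z (Fin.last 2) < q (Fin.init z)} ∧ r.integrand = f ∧ of r - of r' ∈ S := by
  obtain ⟨hΨ, hΨ', hinjΨ⟩ := baseMap_covData hσ hφs hφ' hinj
  have himg := image_baseMap φ I
  set D : Set (Fin 3 → ℝ) := {z | Fin.init z ∈ {b : Fin 2 → ℝ | b 0 ∈ I} ∧ 1 < z (Fin.last 2) ∧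
      z (Fin.last 2) < q (Fin.init z)} with hD
  have hc1 : IsSemialgebraicFunOn ℚ {b : Fin 2 → ℝ | b 0 ∈ I} (fun _ => (1 : ℝ)) := by
    simpa using isSemialgebraicFunOn_ratCast hσ 1
  have hDs : IsSemialgebraic ℚ D := isSemialgebraic_oband hc1 hq
  have hDσ : D ⊆ {z | Fin.init z ∈ {b : Fin 2 → ℝ | b 0 ∈ I}} := fun z hz => by
    rw [hD] at hz; exact hz.1
  obtain ⟨h1, h2, h3⟩ := baseLift_covData hΨ hΨ' hinjΨ hDs hDσ
  have h4 : (fun z : Fin 3 → ℝ => (Fin.snoc (![φ ((Fin.init z) 0), (Fin.init z) 1] : Fin 2 → ℝ) (z (Fin.last 2)) :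
      Fin 3 → ℝ)) '' D = r'.domain := by
    rw [hr']
    refine image_baseLift (Ψ := fun b : Fin 2 → ℝ => (![φ (b 0), b 1] : Fin 2 → ℝ)) hDσ ?_ fun b hb u => ?_
    · intro z hz
      rw [himg, hJ]
      exact hz.1
    · simp only [hD, mem_setOf_eq, Fin.init_snoc, Fin.snoc_last, Matrix.cons_val_zero]
      rw [← hJ, hqq' b hb]
      exact ⟨fun h => ⟨mem_image_of_mem φ hb, h.2⟩, fun h => ⟨hb, h.2⟩⟩
  obtain ⟨r, hd, hi, hrel⟩ := exists_preimage_rep r' hDs h1 h2 h3 h4 hf (fun z hz => by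
    rw [hint z hz, det_baseLiftDeriv, det_baseMapDeriv])
  exact ⟨r, hd, hi, mem_of_mem_changeOfVariablesRel hS hrel⟩

/-- **Matching band representations under a base map.** With `φ` as above, `φ '' I = J`,
`q b = q' (Ψ b)` on `I`, representations `r` on `{b 0 ∈ I, 1 < u < q b}` and `r'` on
`{b 0 ∈ J, 1 < u < q' b}` with `r.integrand (b,u) = r'.integrand (Ψ b, u) · |φ'(b 0)|` on
`r.domain`: `[r] − [r'] ∈ S`. [Kontsevich–Zagier 2001, §1.2, rule 2)] [folklore] -/
theorem of_sub_of_mem_baseMap (hS : domainAddRel ∪ integrandAddRel ∪ changeOfVariablesRel ⊆ S)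
    {I J : Set ℝ} {φ φ' : ℝ → ℝ} (hσ : IsSemialgebraic ℚ {b : Fin 2 → ℝ | b 0 ∈ I})
    (hφs : IsSemialgebraicFunOn ℚ {b : Fin 2 → ℝ | b 0 ∈ I} (fun b => φ (b 0)))
    (hφ' : ∀ t ∈ I, HasDerivAt φ (φ' t) t) (hinj : InjOn φ I) (hJ : φ '' I = J)
    {q q' : (Fin 2 → ℝ) → ℝ} (hqq' : ∀ b : Fin 2 → ℝ, b 0 ∈ I → q b = q' ![φ (b 0), b 1])
    (r r' : IntegralRep 3)
    (hr : r.domain = {z : Fin 3 → ℝ | Fin.init z ∈ {b : Fin 2 → ℝ | b 0 ∈ I} ∧ 1 < z (Fin.last 2) ∧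
      z (Fin.last 2) < q (Fin.init z)})
    (hr' : r'.domain = {z : Fin 3 → ℝ | Fin.init z ∈ {b : Fin 2 → ℝ | b 0 ∈ J} ∧ 1 < z (Fin.last 2) ∧
      z (Fin.last 2) < q' (Fin.init z)})
    (hint : ∀ z ∈ r.domain, r.integrand z =
      r'.integrand (Fin.snoc (![φ ((Fin.init z) 0), (Fin.init z) 1] : Fin 2 → ℝ) (z (Fin.last 2))) *
        |φ' ((Fin.init z) 0)|) :
    of r - of r' ∈ S := by
  obtain ⟨hΨ, hΨ', hinjΨ⟩ := baseMap_covData hσ hφs hφ' hinj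
  have himg := image_baseMap φ I
  refine of_sub_of_mem_baseLift hS hΨ hΨ' hinjΨ r r' (fun z hz => by rw [hr] at hz; exact hz.1)
    (fun z hz => by rw [hr'] at hz; rw [himg, hJ]; exact hz.1) (fun b hb u => ?_) (fun z hz => ?_)
  · rw [hr, hr']
    simp only [mem_setOf_eq, Fin.init_snoc, Fin.snoc_last, Matrix.cons_val_zero]
    rw [← hJ, hqq' b hb]
    exact ⟨fun h => ⟨mem_image_of_mem φ hb, h.2⟩, fun h => ⟨hb, h.2⟩⟩
  · rw [hint z hz, det_baseMapDeriv]

/-! ### Semialgebraic cylinders over intervals of the first coordinate -/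

/-- `{b | p < b 0}` (`p ∈ ℚ`) is `ℚ`-semialgebraic in `ℝ²`. [folklore] -/
theorem isSemialgebraic_fin_two_gt (p : ℚ) : IsSemialgebraic ℚ {b : Fin 2 → ℝ | (p : ℝ) < b 0} := by
  have h := isSemialgebraic_setOf_eval_lt (k := ℚ) (R := ℝ)
    (MvPolynomial.C p : MvPolynomial (Fin 2) ℚ) (MvPolynomial.X 0)
  simp only [MvPolynomial.aeval_X, MvPolynomial.aeval_C] at h
  exact h

/-- `{b | b 0 < p}` (`p ∈ ℚ`) is `ℚ`-semialgebraic in `ℝ²`. [folklore] -/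
theorem isSemialgebraic_fin_two_lt (p : ℚ) : IsSemialgebraic ℚ {b : Fin 2 → ℝ | b 0 < (p : ℝ)} := by
  have h := isSemialgebraic_setOf_eval_lt (k := ℚ) (R := ℝ)
    (MvPolynomial.X 0) (MvPolynomial.C p : MvPolynomial (Fin 2) ℚ)
  simp only [MvPolynomial.aeval_X, MvPolynomial.aeval_C] at h
  exact h

/-- `{b | p < b 0 ²}` (`p ∈ ℚ`) is `ℚ`-semialgebraic in `ℝ²`. [folklore] -/
theorem isSemialgebraic_fin_two_sq_gt (p : ℚ) : IsSemialgebraic ℚ {b : Fin 2 → ℝ | (p : ℝ) < b 0 ^ 2} := by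
  have h := isSemialgebraic_setOf_eval_lt (k := ℚ) (R := ℝ)
    (MvPolynomial.C p : MvPolynomial (Fin 2) ℚ) (MvPolynomial.X 0 ^ 2)
  simp only [map_pow, MvPolynomial.aeval_X, MvPolynomial.aeval_C] at h
  exact h

/-- `{b | b 0 ² < p}` (`p ∈ ℚ`) is `ℚ`-semialgebraic in `ℝ²`. [folklore] -/
theorem isSemialgebraic_fin_two_sq_lt (p : ℚ) : IsSemialgebraic ℚ {b : Fin 2 → ℝ | b 0 ^ 2 < (p : ℝ)} := by
  have h := isSemialgebraic_setOf_eval_lt (k := ℚ) (R := ℝ)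
    (MvPolynomial.X 0 ^ 2) (MvPolynomial.C p : MvPolynomial (Fin 2) ℚ)
  simp only [map_pow, MvPolynomial.aeval_X, MvPolynomial.aeval_C] at h
  exact h

/-- The arc `{0 < t < 1/√3}` as a cylinder: `{b | b 0 ∈ (0, 1/√3)} = {0 < b 0} ∩ {b 0 ² < 1/3}`, hence
`ℚ`-semialgebraic. [folklore] -/
theorem isSemialgebraic_arc : IsSemialgebraic ℚ {b : Fin 2 → ℝ | b 0 ∈ Ioo 0 (Real.sqrt 3)⁻¹} := by
  have h := (isSemialgebraic_fin_two_gt 0).inter (isSemialgebraic_fin_two_sq_lt (1 / 3))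
  convert h using 1
  ext b
  simp only [mem_setOf_eq, mem_Ioo, mem_inter_iff, Rat.cast_zero, Rat.cast_div, Rat.cast_one,
    Rat.cast_ofNat]
  have h3 : (0 : ℝ) < Real.sqrt 3 := Real.sqrt_pos.2 (by norm_num)
  have hsq : (Real.sqrt 3)⁻¹ ^ 2 = 1 / 3 := by
    rw [inv_pow, Real.sq_sqrt (by norm_num : (0:ℝ) ≤ 3), one_div]
  constructor
  · rintro ⟨h0, h1⟩
    refine ⟨h0, ?_⟩
    rw [← hsq]
    exact pow_lt_pow_left₀ h1 h0.le two_ne_zero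
  · rintro ⟨h0, h1⟩
    refine ⟨h0, ?_⟩
    rw [← hsq] at h1
    exact lt_of_pow_lt_pow_left₀ 2 (inv_pos.2 h3).le h1

/-- The Smyth window `{−√3 < x < √3}` as a cylinder: `{b | b 0 ∈ (−√3, √3)} = {b 0 ² < 3}`, hence
`ℚ`-semialgebraic. [folklore] -/
theorem isSemialgebraic_window : IsSemialgebraic ℚ {b : Fin 2 → ℝ | b 0 ∈ Ioo (-Real.sqrt 3) (Real.sqrt 3)} := by
  convert isSemialgebraic_fin_two_sq_lt 3 using 1
  ext b
  simp only [mem_setOf_eq, mem_Ioo, Rat.cast_ofNat]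
  rw [← abs_lt, ← sq_abs (b 0)]
  exact Real.lt_sqrt (abs_nonneg _)

end Summit.KontsevichZagierPeriods.KontsevichZagierPeriods.Theorems
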